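import Literature.AnabelianGeometry.SemiGraphs.TemperedAnabelian
import Literature.AnabelianGeometry.SemiGraphs.TemperedCompletionOpenSubgroups
import Literature.GroupTheory.CombinatorialGroupTheory.VirtuallyFreeProfinitelyDense
import Mathlib.GroupTheory.FreeGroup.NielsenSchreier
import Mathlib.GroupTheory.Schreier
import Mathlib.Topology.Algebra.OpenSubgroup
import HarnessLib

/-!
# [SemiAnbd] Lemma 6.3 (ii): DFG-type ⟺ DOF-type, from the virtually free quotients of a tempered group

Mochizuki, *Semi-graphs of anabelioids*, Publ. RIMS **42** (2006) [SemiAnbd], §6, Lemma 6.3 (ii),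
author's manuscript p. 70: "Let `F` be either `Π^temp_{X_K}` or `Δ^temp_X`; write `F̂` for the
profinite completion of `F`.  Then a subgroup `H ⊆ F` is of DFG-type if and only if it is of
DOF-type."  Printed proof (p. 70): "by replacing `F` by an open subgroup of `F` of finite index
containing `H`, we may assume that `H` is dense in `F̂`.  Now sufficiency is immediate.  To prove
necessity, we note that it follows from assertion (i) [a finitely generated subgroup of a free group
which is dense in the profinite completion is everything], together with the assumption that `H` is
dense in `F̂`, that the image of `H` in each `F/J` is equal to `F/J`, i.e., that `H` is dense in `F`,
as desired." [cite: MochizukiSemiAnbd2006, Lem 6.3(ii) p.70]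

This PROOF-ONLY file (abc-iut cell, sub-DAG `SemiAnbd:Lem6.3(ii)`, prover abc-iut-w5-d240) proves
the lemma in GENERIC form over the §6 interface `IsProfiniteCompletion ι` (`TemperedAnabelian.lean`),
MODULO the one structural property of `F = Π^temp` that the printed appeal to "assertion (i)" uses:

  (VF) `F` has a neighbourhood basis of `1` consisting of open normal subgroups `J` such that the
  discrete group `F/J` is finitely generated and VIRTUALLY FREE

— for `Π^temp_{X_K}` this is [André 2003, §4.5]: `π₁^temp(X^an) = lim_n Δ_n` with `Δ_n` an extension of
the finite `Gal(X_n/X)` by the finitely generated free group `π₁^top(X_n^an)`, "`Δ_n` is virtually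
free"; cf. [SemiAnbd] Prop. 3.6's construction p. 38, "`Gal(𝒢_∞,i/𝒢_i)` is a free discrete group".
The free-group input "assertion (i)" enters through the tree's M. Hall separability
(`FreeGroupSubgroupSeparable`, `VirtuallyFreeProfinitelyDense`: a finitely generated profinitely
dense subgroup of a virtually free group is everything).

* `isDOFType_of_isDFGType` — necessity ("DFG ⇒ DOF") under (VF);
* `isDFGType_of_isDOFType` — sufficiency ("DOF ⇒ DFG") under finite generation of the discrete
  quotients `F/J` (a consequence of (VF));
* `TemperedCurve.piTempDFGIffDOF_of_virtuallyFreeQuotients` — the typed node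
  `TemperedCurve.PiTempDFGIffDOF X` ([SemiAnbd] Lem. 6.3 (ii) for `F = Π^temp_{X_K}`) from (VF) for
  `X.PiTemp`.

The case `F = Δ^temp_X` of the typed node (`DeltaTempDFGIffDOF`) is over `X.deltaToHat`, whose
`IsProfiniteCompletion` property is not an interface axiom; it is not treated here.  Classical
group theory; nothing here concerns the disputed parts of inter-universal Teichmüller theory or takes
a side on [IUTchIII] Cor. 3.12.
-/

noncomputable section

namespace Literature.AnabelianGeometry.SemiGraphs

namespace IsProfiniteCompletion

open _root_.Topology
open Literature.GroupTheory.CombinatorialGroupTheory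

universe u v

variable {F : Type u} {Fhat : Type v} [Group F] [TopologicalSpace F] [IsTopologicalGroup F]
  [Group Fhat] [TopologicalSpace Fhat] [IsTopologicalGroup Fhat] {ι : F →ₜ* Fhat}

/-! ### Density transfer from the profinite completion to the open subgroups of finite index -/

/-- If `ι(f)` lies in the closure of `ι(H)` in `F̂`, then `f` is congruent to an element of `H` modulo
every open subgroup of finite index `P ≤ F` (the closure of `ι(P)` is open and pulls back to `P`,
[SemiAnbd] §6 p. 69 "natural injections"). [cite: MochizukiSemiAnbd2006, Lem 6.3(ii) p.70] -/
theorem exists_mem_inv_mul_mem_of_mem_closure (hι : IsProfiniteCompletion ι) (H : Subgroup F)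
    {f : F} (hf : ι f ∈ closure (ι '' (H : Set F))) (P : Subgroup F) (hP : IsOpen (P : Set F))
    [P.FiniteIndex] : ∃ h ∈ H, f⁻¹ * h ∈ P := by
  -- the open neighbourhood `ι(f) · closure(ι P)` of `ι f` meets `ι(H)`
  have hopen : IsOpen ((fun z => ι f * z) '' closure (ι '' (P : Set F))) :=
    (Homeomorph.mulLeft (ι f)).isOpenMap _ (isOpen_closure_image hι P hP)
  have hmem : ι f ∈ (fun z => ι f * z) '' closure (ι '' (P : Set F)) :=
    ⟨1, subset_closure ⟨1, P.one_mem, map_one ι⟩, mul_one _⟩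
  obtain ⟨z, ⟨w, hw, rfl⟩, ⟨h, hh, hhz⟩⟩ := mem_closure_iff.mp hf _ hopen hmem
  refine ⟨h, hh, mem_of_map_mem_closure hι P hP ?_⟩
  have : ι (f⁻¹ * h) = w := by
    rw [map_mul, map_inv, hhz, ← mul_assoc, inv_mul_cancel, one_mul]
  rw [this]; exact hw

/-! ### Necessity: DFG-type ⇒ DOF-type -/

/-- **[SemiAnbd] Lemma 6.3 (ii), necessity ("DFG ⇒ DOF")**, generic form over the interface
`IsProfiniteCompletion ι : F → F̂`, MODULO the structural property (VF) of `F`: every neighbourhood of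
`1` contains an open normal subgroup `J` with `F/J` finitely generated and virtually free.  Printed
proof p. 70: replace `F` by the open finite-index subgroup `F₁ := ι⁻¹(closure ι(H)) ⊇ H`; for each such
`J` the image of `H` in `F/J` is finitely generated (DFG hypothesis) and profinitely dense in the image
of `F₁` (density of `ι(H)` in `closure ι(H)` transferred to the finite-index subgroups), hence equals it
by "assertion (i)" for the virtually free group `F/J` — so `H` is dense in `F₁`.
[cite: MochizukiSemiAnbd2006, Lem 6.3(ii) p.70] -/
theorem isDOFType_of_isDFGType (hι : IsProfiniteCompletion ι)
    (hVF : ∀ U ∈ 𝓝 (1 : F), ∃ J : OpenNormalSubgroup F, (J : Set F) ⊆ U ∧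
      Group.FG (F ⧸ J.toSubgroup) ∧ ∃ N : Subgroup (F ⧸ J.toSubgroup),
        N.Normal ∧ N.FiniteIndex ∧ IsFreeGroup N)
    (H : Subgroup F) (hH : IsDFGType ι H) : IsDOFType H := by
  classical
  haveI : CompactSpace Fhat := hι.compactSpace
  obtain ⟨⟨V, hVo, hVcl⟩, hfg⟩ := hH
  -- `F₁ := ι⁻¹(V)`, an open subgroup of finite index containing `H`
  haveI : V.FiniteIndex := by
    haveI : Finite (Fhat ⧸ V) := Subgroup.quotient_finite_of_isOpen V hVo
    exact Subgroup.finiteIndex_of_finite_quotient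
  let F₁ : Subgroup F := V.comap ι.toMonoidHom
  have hF₁o : IsOpen (F₁ : Set F) := hVo.preimage ι.continuous
  haveI hF₁fi : F₁.FiniteIndex := by
    haveI : V.IsFiniteRelIndex ι.toMonoidHom.range := Subgroup.isFiniteRelIndex_of_finiteIndex
    exact ⟨by rw [Subgroup.index_comap]; exact Subgroup.relIndex_ne_zero⟩
  have hHF₁ : H ≤ F₁ := fun h hh => by
    change ι h ∈ (V : Set Fhat)
    rw [← hVcl]
    exact subset_closure ⟨h, hh, rfl⟩
  have hF₁cl : ∀ f ∈ F₁, ι f ∈ closure (ι '' (H : Set F)) := fun f hf => by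
    rw [hVcl]; exact hf
  refine ⟨F₁, hF₁o, hF₁fi, ?_⟩
  apply le_antisymm
  · exact closure_minimal (fun h hh => hHF₁ hh) (Subgroup.isClosed_of_isOpen _ hF₁o)
  intro x hx
  rw [mem_closure_iff_nhds]
  intro O hO
  -- a small open normal subgroup `J ⊆ x⁻¹ O` with `F/J` finitely generated and virtually free
  have hU₀ : (fun y => x * y) ⁻¹' O ∈ 𝓝 (1 : F) :=
    ((continuous_const.mul continuous_id : Continuous fun y : F => x * y).continuousAt
      ).preimage_mem_nhds (by simpa using hO)
  obtain ⟨J, hJU, hJfg, N, hNn, hNfi, hNfree⟩ := hVF _ hU₀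
  haveI := hNn; haveI := hNfi; haveI := hNfree; haveI := hJfg
  -- it suffices to find `h ∈ H` with `x⁻¹ h ∈ J`
  suffices key : ∃ h ∈ H, x⁻¹ * h ∈ J.toSubgroup by
    obtain ⟨h, hh, hxh⟩ := key
    refine ⟨h, ?_, hh⟩
    have : x * (x⁻¹ * h) ∈ O := hJU hxh
    simpa using this
  -- work in the virtually free quotient `Ḡ := F/J`
  let π : F →* F ⧸ J.toSubgroup := QuotientGroup.mk' J.toSubgroup
  have hπ : Function.Surjective π := QuotientGroup.mk'_surjective _
  let Fb : Subgroup (F ⧸ J.toSubgroup) := F₁.map π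
  let Hb : Subgroup (F ⧸ J.toSubgroup) := H.map π
  have hle : Hb ≤ Fb := Subgroup.map_mono hHF₁
  haveI hFbfi : Fb.FiniteIndex :=
    ⟨fun h0 => hF₁fi.index_ne_zero (Nat.eq_zero_of_zero_dvd (h0 ▸ Subgroup.index_map_dvd F₁ hπ))⟩
  -- the free normal finite-index subgroup `M := N ∩ F̄₁` of `F̄₁`
  let M : Subgroup Fb := N.subgroupOf Fb
  haveI : IsFreeGroup ((N ⊓ Fb).subgroupOf N) := inferInstance
  have eM₀ : (N ⊓ Fb).subgroupOf N ≃* M :=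
    ((Subgroup.subgroupOfEquivOfLe (inf_le_left : N ⊓ Fb ≤ N)).trans
      (Subgroup.subgroupOfEquivOfLe (inf_le_right : N ⊓ Fb ≤ Fb)).symm).trans
      (MulEquiv.subgroupCongr (Subgroup.inf_subgroupOf_right N Fb))
  haveI : IsFreeGroup M := IsFreeGroup.ofMulEquiv eM₀
  -- `H̄₁ := H̄ ∩ F̄₁ = H̄` inside `F̄₁` is finitely generated
  let Hb₁ : Subgroup Fb := Hb.subgroupOf Fb
  have hHb₁fg : Hb₁.FG := by
    haveI : Group.FG Hb := (Group.fg_iff_subgroup_fg Hb).mpr (hfg J)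
    haveI : Group.FG Hb₁ :=
      Group.fg_of_surjective (f := (Subgroup.subgroupOfEquivOfLe hle).symm.toMonoidHom)
        (Subgroup.subgroupOfEquivOfLe hle).symm.surjective
    exact (Group.fg_iff_subgroup_fg Hb₁).mp inferInstance
  -- and profinitely dense in `F̄₁`
  have hdense : ∀ P : Subgroup Fb, P.Normal → P.FiniteIndex → Hb₁ ⊔ P = ⊤ := by
    intro P hPn hPfi
    let P' : Subgroup (F ⧸ J.toSubgroup) := P.map Fb.subtype
    haveI : P'.FiniteIndex := ⟨by
      rw [Subgroup.index_map_subtype]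
      exact mul_ne_zero hPfi.index_ne_zero hFbfi.index_ne_zero⟩
    let P₁ : Subgroup F := P'.comap π ⊓ F₁
    haveI : (P'.comap π).FiniteIndex := ⟨by
      rw [Subgroup.index_comap_of_surjective _ hπ]; exact Subgroup.FiniteIndex.index_ne_zero⟩
    haveI : P₁.FiniteIndex := inferInstance
    have hP₁o : IsOpen (P₁ : Set F) := by
      refine Subgroup.isOpen_mono (H₁ := J.toSubgroup ⊓ F₁) ?_ (J.isOpen.inter hF₁o)
      rintro j ⟨hj, hjF⟩
      refine ⟨?_, hjF⟩
      change π j ∈ P'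
      have : π j = 1 := (QuotientGroup.eq_one_iff j).mpr hj
      rw [this]; exact P'.one_mem
    refine top_le_iff.mp fun y _ => ?_
    obtain ⟨f, hf, hfy⟩ := y.2
    obtain ⟨h, hh, hfh⟩ := exists_mem_inv_mul_mem_of_mem_closure hι H (hF₁cl f hf) P₁ hP₁o
    -- `π f = π h · π (h⁻¹ f)` with `π h ∈ H̄₁` and `π (h⁻¹ f) ∈ P`
    have hq : π (h⁻¹ * f) ∈ P' := by
      have : h⁻¹ * f = (f⁻¹ * h)⁻¹ := by group
      rw [this, map_inv]
      exact P'.inv_mem hfh.1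
    obtain ⟨q, hq, hqe⟩ := hq
    have hqe' : (q : F ⧸ J.toSubgroup) = π (h⁻¹ * f) := hqe
    have hhF : π h ∈ Fb := ⟨h, hHF₁ hh, rfl⟩
    have hy : y = ⟨π h, hhF⟩ * q := by
      apply Subtype.ext
      change y.1 = π h * (q : F ⧸ J.toSubgroup)
      rw [hqe', ← map_mul, mul_inv_cancel_left, hfy]
    rw [hy]
    refine Subgroup.mul_mem _ (Subgroup.mem_sup_left ?_) (Subgroup.mem_sup_right hq)
    change π h ∈ Hb
    exact ⟨h, hh, rfl⟩
  have htop : Hb₁ = ⊤ :=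
    VirtuallyFree.eq_top_of_fg_of_forall_sup_eq_top_of_virtuallyFree M (IsFreeGroup.toFreeGroup M)
      Hb₁ hHb₁fg hdense
  -- hence `π x ∈ H̄`
  have hxFb : π x ∈ Fb := ⟨x, hx, rfl⟩
  have hxHb : π x ∈ Hb := by
    have : (⟨π x, hxFb⟩ : Fb) ∈ Hb₁ := by rw [htop]; exact Subgroup.mem_top _
    exact this
  obtain ⟨h, hh, hhx⟩ := hxHb
  refine ⟨h, hh, ?_⟩
  have : h⁻¹ * x ∈ J.toSubgroup := QuotientGroup.eq.mp (by exact hhx)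
  have h2 := J.toSubgroup.inv_mem this
  simpa using h2

/-! ### Sufficiency: DOF-type ⇒ DFG-type -/

/-- **[SemiAnbd] Lemma 6.3 (ii), sufficiency ("DOF ⇒ DFG")**, generic form over the interface
`IsProfiniteCompletion ι`, assuming the discrete quotients `F/J` (`J` open normal) are finitely
generated: if `H` is dense in an open subgroup `U` of finite index, then `closure ι(H) = closure ι(U)`
is open in `F̂`, and the image of `H` in each `F/J` is the image of `U`, a finite-index subgroup of a
finitely generated group, hence finitely generated ("sufficiency is immediate", p. 70).
[cite: MochizukiSemiAnbd2006, Lem 6.3(ii) p.70] -/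
theorem isDFGType_of_isDOFType (hι : IsProfiniteCompletion ι)
    (hFG : ∀ J : OpenNormalSubgroup F, Group.FG (F ⧸ J.toSubgroup))
    (H : Subgroup F) (hH : IsDOFType H) : IsDFGType ι H := by
  classical
  obtain ⟨U, hUo, hUfi, hUcl⟩ := hH
  haveI := hUfi
  have hHU : H ≤ U := fun h hh => by
    rw [← SetLike.mem_coe, ← hUcl]; exact subset_closure hh
  -- density of `H` in `U`: `u J` meets `H` for every open subgroup `J`
  have hdense : ∀ J : Subgroup F, IsOpen (J : Set F) → ∀ u ∈ U, ∃ h ∈ H, u⁻¹ * h ∈ J := by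
    intro J hJ u hu
    have hu' : u ∈ closure (H : Set F) := by rw [hUcl]; exact hu
    have hopen : IsOpen ((fun y => u * y) '' (J : Set F)) := (Homeomorph.mulLeft u).isOpenMap _ hJ
    obtain ⟨z, ⟨j, hj, rfl⟩, hzH⟩ := mem_closure_iff.mp hu' _ hopen ⟨1, J.one_mem, mul_one u⟩
    exact ⟨u * j, hzH, by simpa using hj⟩
  refine ⟨⟨(U.map ι.toMonoidHom).topologicalClosure, isOpen_topologicalClosure_map hι U hUo, ?_⟩,
    fun J => ?_⟩
  · rw [Subgroup.topologicalClosure_coe, Subgroup.coe_map]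
    apply le_antisymm
    · exact closure_mono (Set.image_mono hHU)
    · refine closure_minimal ?_ isClosed_closure
      change ι '' (U : Set F) ⊆ closure (ι '' (H : Set F))
      calc ι '' (U : Set F) = ι '' closure (H : Set F) := by rw [hUcl]
        _ ⊆ closure (ι '' (H : Set F)) := image_closure_subset_closure_image ι.continuous
  · have heq : H.map (QuotientGroup.mk' J.toSubgroup) = U.map (QuotientGroup.mk' J.toSubgroup) := by
      apply le_antisymm (Subgroup.map_mono hHU)
      rintro _ ⟨u, hu, rfl⟩
      obtain ⟨h, hh, huh⟩ := hdense J.toSubgroup J.isOpen u hu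
      exact ⟨h, hh, (QuotientGroup.eq.mpr huh).symm⟩
    rw [heq]
    haveI := hFG J
    haveI : (U.map (QuotientGroup.mk' J.toSubgroup)).FiniteIndex :=
      ⟨fun h0 => hUfi.index_ne_zero (Nat.eq_zero_of_zero_dvd
        (h0 ▸ Subgroup.index_map_dvd U (QuotientGroup.mk'_surjective _)))⟩
    exact (Group.fg_iff_subgroup_fg _).mp inferInstance

omit [IsTopologicalGroup F] in
/-- Finite generation of all discrete quotients `F/J` from (VF): every open normal `J'` contains some
`J` of the basis, and `F/J'` is a quotient of the finitely generated `F/J`. [folklore] -/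
private theorem fg_quotient_of_virtuallyFreeQuotients
    (hVF : ∀ U ∈ 𝓝 (1 : F), ∃ J : OpenNormalSubgroup F, (J : Set F) ⊆ U ∧
      Group.FG (F ⧸ J.toSubgroup) ∧ ∃ N : Subgroup (F ⧸ J.toSubgroup),
        N.Normal ∧ N.FiniteIndex ∧ IsFreeGroup N)
    (J' : OpenNormalSubgroup F) : Group.FG (F ⧸ J'.toSubgroup) := by
  obtain ⟨J, hJ, hfg, -⟩ := hVF _ (J'.isOpen.mem_nhds J'.toSubgroup.one_mem)
  haveI := hfg
  have hle : J.toSubgroup ≤ J'.toSubgroup := fun x hx => hJ hx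
  refine Group.fg_of_surjective
    (f := QuotientGroup.map J.toSubgroup J'.toSubgroup (MonoidHom.id F) fun x hx => hle hx) ?_
  intro y
  obtain ⟨x, rfl⟩ := QuotientGroup.mk_surjective y
  exact ⟨x, rfl⟩

end IsProfiniteCompletion

/-! ### The typed node: [SemiAnbd] Lemma 6.3 (ii) for `F = Π^temp_{X_K}` -/

namespace TemperedCurve

open _root_.Topology

variable {p : ℕ} [Fact p.Prime]

/-- **[SemiAnbd] Lemma 6.3 (ii) for `F = Π^temp_{X_K}`** (the typed node `PiTempDFGIffDOF`,
TemperedAnabelian.lean): PROVED modulo the structural property (VF) of `Π^temp_{X_K}` — a neighbourhood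
basis of `1` of open normal subgroups `J` with `Π^temp_{X_K}/J` finitely generated and virtually free
([André 2003, §4.5]; [SemiAnbd] Prop. 3.6 p. 38) — which is the content the printed proof (p. 70)
draws from Lemma 6.3 (i). [cite: MochizukiSemiAnbd2006, Lem 6.3(ii) p.70] -/
theorem piTempDFGIffDOF_of_virtuallyFreeQuotients (X : TemperedCurve p)
    (hVF : ∀ U ∈ 𝓝 (1 : X.PiTemp), ∃ J : OpenNormalSubgroup X.PiTemp, (J : Set X.PiTemp) ⊆ U ∧
      Group.FG (X.PiTemp ⧸ J.toSubgroup) ∧ ∃ N : Subgroup (X.PiTemp ⧸ J.toSubgroup),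
        N.Normal ∧ N.FiniteIndex ∧ IsFreeGroup N) :
    X.PiTempDFGIffDOF := fun H =>
  ⟨IsProfiniteCompletion.isDOFType_of_isDFGType X.isProfiniteCompletion_toHat hVF H,
    IsProfiniteCompletion.isDFGType_of_isDOFType X.isProfiniteCompletion_toHat
      (IsProfiniteCompletion.fg_quotient_of_virtuallyFreeQuotients hVF) H⟩

/-- **[SemiAnbd] Lemma 6.3 (ii) for `F = Δ^temp_X`** (the typed node `DeltaTempDFGIffDOF`): the same
generic argument applied to `Δ^temp_X ↪ Δ_X`, under the additional hypothesis that this map IS a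
profinite completion in the sense of the interface (`IsProfiniteCompletion X.deltaToHat` — for the
curve-level interface this is not an axiom but part of the geometric origin) and (VF) for `Δ^temp_X`
([André 2003, §4.5]: `Δ_n` virtually free). [cite: MochizukiSemiAnbd2006, Lem 6.3(ii) p.70] -/
theorem deltaTempDFGIffDOF_of_virtuallyFreeQuotients (X : TemperedCurve p)
    (hΔ : IsProfiniteCompletion X.deltaToHat)
    (hVF : ∀ U ∈ 𝓝 (1 : X.DeltaTemp), ∃ J : OpenNormalSubgroup X.DeltaTemp,
      (J : Set X.DeltaTemp) ⊆ U ∧ Group.FG (X.DeltaTemp ⧸ J.toSubgroup) ∧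
        ∃ N : Subgroup (X.DeltaTemp ⧸ J.toSubgroup), N.Normal ∧ N.FiniteIndex ∧ IsFreeGroup N) :
    X.DeltaTempDFGIffDOF := fun H =>
  ⟨IsProfiniteCompletion.isDOFType_of_isDFGType hΔ hVF H,
    IsProfiniteCompletion.isDFGType_of_isDOFType hΔ
      (IsProfiniteCompletion.fg_quotient_of_virtuallyFreeQuotients hVF) H⟩

end TemperedCurve

end Literature.AnabelianGeometry.SemiGraphs

end
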